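import Literature.NumberTheory.GaloisRepresentations.AbsDecompositionGroupsInfiniteProper
import Mathlib.FieldTheory.Separable
import HarnessLib

/-!
# Decomposition groups of the finite places of `K̄` have INFINITE INDEX: infinitely many primes of `ℤ̄` above
# every finite place

Topic `Literature/NumberTheory/GaloisRepresentations` (sequel to `AbsDecompositionGroupsInfiniteProper`).  `K` a number
field, `K̄ = AlgebraicClosure K`, `G_K = Field.absoluteGaloisGroup K`, `ℤ̄ = absIntegers (𝓞 K) K`, `𝔓` a maximal ideal of
`ℤ̄` over the finite place `𝔭 = 𝔓 ∩ 𝓞 K`.  Classical fact (Neukirch, *Algebraic Number Theory*, Ch. II §8–§9: above a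
finite place of `K` there are infinitely many places of `K̄`; `D_𝔓` is a closed subgroup of infinite index), proved
here by an ELEMENTARY counting argument extending the Eisenstein pair of the prequel:

* `eq_of_pow_add_mul_pow_add_eq_zero_of_notMem` — for a prime `𝔔` of a domain with `a ∉ 𝔔 ∋ b`, the equation
  `x^(m+2) + a x^(m+1) + b = 0` has AT MOST ONE solution outside `𝔔` (two such solutions `x ≠ y` reduce to `−a` and
  satisfy `Σ xⁱyʲ + aΣ xⁱyʲ = 0`, whose reduction is `(−a)^(m+1) ≠ 0`);
* `RingOfIntegers.irreducible_X_pow_add_C_mul_X_pow_add_C` — `X^(m+2) + aX^(m+1) + b` with `a ∈ 𝔮`, `b ∈ 𝔮 ∖ 𝔮²` is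
  irreducible over `K` (Eisenstein at `𝔮` + Gauss);
* `absIntegers.infinite_orbit` — **the `G_K`-orbit of `𝔓` is infinite**: with `a ∈ 𝔮 ∖ 𝔭`, `b ∈ 𝔭𝔮 ∖ 𝔮²` the `m + 2`
  distinct roots of that polynomial are algebraic integers of which exactly one lies outside any given conjugate of `𝔓`,
  so root `z ↦` "the conjugate missing `z`" injects the `m + 2` roots into the orbit — for every `m`;
* `absIntegers.index_stabilizer_eq_zero`, `absIntegers.not_finiteIndex_stabilizer`, `absIntegers.not_isOpen_stabilizer` —
  **`[G_K : D_𝔓] = ∞`, `D_𝔓` is not open**;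
* `IsDedekindDomain.HeightOneSpectrum.infinite_primesAbove` — **infinitely many primes of `ℤ̄` lie above each finite
  place `v` of `K`**;
* `ValuationSubring.infinite_orbit_of_ne_top`, `.index_stabilizer_eq_zero_of_ne_top`, `.not_isOpen_stabilizer_of_ne_top` —
  the same for a non-trivial valuation ring `A` of `K̄` (via the centre `𝔪_A ∩ ℤ̄`).

abc-iut cell use (seat abc-iut-f-053 gen 3, row «D𝔓-INFINITE-INDEX»): the (S⊚′) hypothesis «only `⊚` has an OPEN
decomposition group» of [AbsTopIII] Def 5.1 at the genuine pro-set, by an elementary route (the cell's file of record,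
`NumberFieldValuationProSetDecomposition.lean`, goes through `D_A ≅ Gal(K̄_v/K_v)`).  Theorems only; classical; nothing
here bears on [IUTchIII] Cor. 3.12.
-/

noncomputable section

open scoped NumberField Pointwise Polynomial

namespace Literature.NumberTheory.GaloisRepresentations

open Field Polynomial IsDedekindDomain Finset

-- as in `AbsIntegersLocalization`: the pointwise `G_K`-actions on `ℤ̄` and on its ideals are found slowly
set_option synthInstance.maxHeartbeats 160000

variable {K : Type*} [Field K]

/-! ### §1. At most one root outside a prime -/

/-- **At most one root outside `𝔔`.**  In a domain `S`, for a prime ideal `𝔔` and `a ∉ 𝔔`, `b ∈ 𝔔`: two solutions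
`x, y ∉ 𝔔` of `t^(m+2) + a t^(m+1) + b = 0` are EQUAL.  (Mod `𝔔` both are `−a`; if `x ≠ y` then
`h = Σ_{i<m+2} xⁱy^{m+1−i} + a Σ_{i<m+1} xⁱy^{m−i}` vanishes since `h (x − y) = g(x) − g(y) = 0`, but
`h ≡ (m+2)(−a)^{m+1} + (m+1) a (−a)^m = (−a)^{m+1} ≢ 0`.) [cite: NeukirchANT1999, Ch. II §8] -/
theorem eq_of_pow_add_mul_pow_add_eq_zero_of_notMem {S : Type*} [CommRing S] [IsDomain S] (𝔔 : Ideal S)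
    [h𝔔 : 𝔔.IsPrime] {a b : S} (ha : a ∉ 𝔔) (hb : b ∈ 𝔔) (m : ℕ) {x y : S}
    (hx : x ^ (m + 2) + a * x ^ (m + 1) + b = 0) (hy : y ^ (m + 2) + a * y ^ (m + 1) + b = 0)
    (hxQ : x ∉ 𝔔) (hyQ : y ∉ 𝔔) : x = y := by
  by_contra hne
  -- reductions mod `𝔔`
  let π := Ideal.Quotient.mk 𝔔
  have hπa : π a ≠ 0 := fun h => ha (Ideal.Quotient.eq_zero_iff_mem.mp h)
  have hπb : π b = 0 := Ideal.Quotient.eq_zero_iff_mem.mpr hb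
  have hred : ∀ {t : S}, t ^ (m + 2) + a * t ^ (m + 1) + b = 0 → t ∉ 𝔔 → π t = -π a := by
    intro t ht htQ
    have hπt : π t ≠ 0 := fun h => htQ (Ideal.Quotient.eq_zero_iff_mem.mp h)
    have h1 : π t ^ (m + 1) * (π t + π a) = 0 := by
      have := congrArg π ht
      rw [map_add, map_add, map_mul, map_pow, map_pow, hπb, add_zero, map_zero] at this
      linear_combination this
    rcases mul_eq_zero.mp h1 with h2 | h2
    · exact absurd (pow_eq_zero_iff (by omega) |>.mp h2) hπt
    · exact eq_neg_of_add_eq_zero_left h2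
  have hxc := hred hx hxQ
  have hyc := hred hy hyQ
  -- `h (x − y) = g(x) − g(y) = 0`, so `h = 0`
  set h : S := (∑ i ∈ range (m + 2), x ^ i * y ^ (m + 2 - 1 - i)) +
    a * ∑ i ∈ range (m + 1), x ^ i * y ^ (m + 1 - 1 - i) with hh
  have hmul : h * (x - y) = 0 := by
    have e1 := geom_sum₂_mul x y (m + 2)
    have e2 := geom_sum₂_mul x y (m + 1)
    rw [hh, add_mul, mul_assoc, e1, e2]
    linear_combination hx - hy
  have h0 : h = 0 := by
    rcases mul_eq_zero.mp hmul with h0 | h0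
    · exact h0
    · exact absurd (sub_eq_zero.mp h0) hne
  -- but `h ≡ (−a)^(m+1) ≠ 0 (mod 𝔔)`
  have hπh : π h = (-π a) ^ (m + 1) := by
    rw [hh, map_add, map_mul, map_sum, map_sum]
    simp only [map_mul, map_pow, hxc, hyc]
    rw [geom_sum₂_self, geom_sum₂_self]
    simp only [Nat.add_sub_cancel]
    push_cast
    ring
  rw [h0, map_zero] at hπh
  exact pow_ne_zero _ (neg_ne_zero.mpr hπa) hπh.symm

/-! ### §2. The degree-`m + 2` Eisenstein polynomial -/

section Eisenstein

variable [NumberField K]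

omit [NumberField K] in
/-- `X^(m+2) + aX^(m+1) + b ∈ 𝓞 K[X]` is monic of degree `m + 2`. [cite: NeukirchANT1999, Ch. II §8] -/
theorem RingOfIntegers.monic_X_pow_add_C_mul_X_pow_add_C (a b : 𝓞 K) (m : ℕ) :
    (X ^ (m + 2) + C a * X ^ (m + 1) + C b : (𝓞 K)[X]).Monic ∧
      (X ^ (m + 2) + C a * X ^ (m + 1) + C b : (𝓞 K)[X]).natDegree = m + 2 := by
  have hlt : (C a * X ^ (m + 1) + C b : (𝓞 K)[X]).degree < (X ^ (m + 2) : (𝓞 K)[X]).degree := by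
    rw [degree_X_pow]
    refine (degree_add_le _ _).trans_lt (max_lt ?_ ?_)
    · exact (degree_C_mul_X_pow_le _ _).trans_lt (by exact_mod_cast Nat.lt_succ_self _)
    · exact degree_C_le.trans_lt (by exact_mod_cast Nat.succ_pos _)
  have heq : (X ^ (m + 2) + C a * X ^ (m + 1) + C b : (𝓞 K)[X]) = X ^ (m + 2) + (C a * X ^ (m + 1) + C b) := by
    ring
  rw [heq]
  exact ⟨(monic_X_pow _).add_of_left hlt, by rw [natDegree_add_eq_left_of_degree_lt hlt, natDegree_X_pow]⟩

/-- **Eisenstein at `𝔮`**: for a prime `𝔮` of `𝓞 K` with `a ∈ 𝔮`, `b ∈ 𝔮 ∖ 𝔮²`, the polynomial `X^(m+2) + aX^(m+1) + b`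
is irreducible over `K` (`irreducible_of_eisenstein_criterion` + Gauss's lemma). [cite: NeukirchANT1999, Ch. II §8] -/
theorem RingOfIntegers.irreducible_X_pow_add_C_mul_X_pow_add_C {𝔮 : Ideal (𝓞 K)} [h𝔮 : 𝔮.IsMaximal] {a b : 𝓞 K}
    (ha : a ∈ 𝔮) (hb : b ∈ 𝔮) (hb2 : b ∉ 𝔮 ^ 2) (m : ℕ) :
    Irreducible ((X ^ (m + 2) + C a * X ^ (m + 1) + C b : (𝓞 K)[X]).map (algebraMap (𝓞 K) K)) := by
  obtain ⟨hmon, hnat⟩ := RingOfIntegers.monic_X_pow_add_C_mul_X_pow_add_C a b m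
  have hdeg : (X ^ (m + 2) + C a * X ^ (m + 1) + C b : (𝓞 K)[X]).degree = (m + 2 : ℕ) := by
    rw [degree_eq_natDegree hmon.ne_zero, hnat]
  have hc0 : (X ^ (m + 2) + C a * X ^ (m + 1) + C b : (𝓞 K)[X]).coeff 0 = b := by simp
  refine (hmon.irreducible_iff_irreducible_map_fraction_map (K := K)).mp
    (irreducible_of_eisenstein_criterion h𝔮.isPrime ?_ ?_ ?_ ?_ hmon.isPrimitive)
  · rw [hmon.leadingCoeff]; exact fun h1 => h𝔮.ne_top ((Ideal.eq_top_iff_one _).mpr h1)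
  · intro n hn
    rw [hdeg] at hn
    have hn' : n < m + 2 := by exact_mod_cast hn
    simp only [coeff_add, coeff_X_pow, coeff_C_mul, coeff_C]
    refine 𝔮.add_mem (𝔮.add_mem ?_ ?_) ?_
    · rw [if_neg (by omega)]; exact 𝔮.zero_mem
    · split_ifs
      · simpa using ha
      · simp
    · split_ifs
      · exact hb
      · exact 𝔮.zero_mem
  · rw [hdeg]; exact_mod_cast Nat.succ_pos _
  · rw [hc0]; exact hb2

end Eisenstein

/-! ### §3. The orbit of `𝔓` under `G_K` is infinite -/

section Orbit

variable [NumberField K]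

/-- **The `G_K`-orbit of a maximal ideal `𝔓` of `ℤ̄` is INFINITE.**  For every `m`, the `m + 2` distinct roots of the
Eisenstein polynomial `X^(m+2) + aX^(m+1) + b` (`a ∈ 𝔮 ∖ 𝔭`, `b ∈ 𝔭𝔮 ∖ 𝔮²`, `𝔭 = 𝔓 ∩ 𝓞 K`, `𝔮 ≠ 𝔭`) are algebraic integers;
exactly one root `z₀` lies outside `𝔓` (`∏ (−a − z) = b ∈ 𝔓` gives one, `eq_of_pow_add_mul_pow_add_eq_zero_of_notMem` at most
one — and the same for every conjugate of `𝔓`); choosing `σ_z ∈ G_K` with `σ_z z₀ = z`, the conjugates `σ_z • 𝔓` (whose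
missing root is `z`) are pairwise distinct. [cite: NeukirchANT1999, Ch. II §8] -/
theorem absIntegers.infinite_orbit (𝔓 : Ideal (absIntegers (𝓞 K) K)) [h𝔓 : 𝔓.IsMaximal] :
    (MulAction.orbit (absoluteGaloisGroup K) 𝔓).Infinite := by
  classical
  intro hfin
  haveI : (𝔓.under (𝓞 K)).IsMaximal := Ideal.IsMaximal.under (𝓞 K) 𝔓
  obtain ⟨𝔮, h𝔮, hne⟩ := RingOfIntegers.exists_isMaximal_ne (𝔓.under (𝓞 K))
  obtain ⟨⟨a, ha𝔮, ha𝔭⟩, ⟨b, hb, hb𝔮⟩⟩ := RingOfIntegers.exists_mem_sdiff_of_isMaximal_ne (K := K) hne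
  have hb𝔭 : b ∈ 𝔓.under (𝓞 K) := Ideal.mul_le_right hb
  -- the images `A, B ∈ ℤ̄` of `a, b`: `A ∉ 𝔔`, `B ∈ 𝔔` for EVERY conjugate `𝔔 = τ • 𝔓`
  set A : absIntegers (𝓞 K) K := algebraMap (𝓞 K) (absIntegers (𝓞 K) K) a with hA
  set B : absIntegers (𝓞 K) K := algebraMap (𝓞 K) (absIntegers (𝓞 K) K) b with hB
  have hAτ : ∀ τ : absoluteGaloisGroup K, A ∉ τ • 𝔓 := by
    intro τ h
    have h' := Ideal.mem_pointwise_smul_iff_inv_smul_mem.mp h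
    rw [hA, smul_algebraMap] at h'
    exact ha𝔭 (Ideal.mem_comap.mpr h')
  have hBτ : ∀ τ : absoluteGaloisGroup K, B ∈ τ • 𝔓 := by
    intro τ
    refine Ideal.mem_pointwise_smul_iff_inv_smul_mem.mpr ?_
    rw [hB, smul_algebraMap]
    exact Ideal.mem_comap.mp hb𝔭
  -- the polynomial, over `𝓞 K`, `K` and `K̄`, with `m := #orbit`
  set m : ℕ := (MulAction.orbit (absoluteGaloisGroup K) 𝔓).ncard with hm
  set g : (𝓞 K)[X] := X ^ (m + 2) + C a * X ^ (m + 1) + C b with hg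
  obtain ⟨hmon, hnat⟩ := RingOfIntegers.monic_X_pow_add_C_mul_X_pow_add_C a b m
  have hirrK : Irreducible (g.map (algebraMap (𝓞 K) K)) :=
    RingOfIntegers.irreducible_X_pow_add_C_mul_X_pow_add_C ha𝔮 (Ideal.mul_le_left hb) hb𝔮 m
  have hmonK : (g.map (algebraMap (𝓞 K) K)).Monic := hmon.map _
  have hnatK : (g.map (algebraMap (𝓞 K) K)).natDegree = m + 2 := by rw [hmon.natDegree_map, hnat]
  have hsep : (g.map (algebraMap (𝓞 K) K)).Separable := hirrK.separable
  set a' : AlgebraicClosure K := algebraMap (𝓞 K) (AlgebraicClosure K) a with ha'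
  set b' : AlgebraicClosure K := algebraMap (𝓞 K) (AlgebraicClosure K) b with hb'
  have haeval : ∀ z : AlgebraicClosure K, aeval z g = z ^ (m + 2) + a' * z ^ (m + 1) + b' := by
    intro z; simp [hg, ha', hb']
  -- the automorphisms of `K̄/K` fix `a'` and `b'`
  have hfix : ∀ (σ : AlgebraicClosure K ≃ₐ[K] AlgebraicClosure K) (c : 𝓞 K),
      σ (algebraMap (𝓞 K) (AlgebraicClosure K) c) = algebraMap (𝓞 K) (AlgebraicClosure K) c := by
    intro σ c
    rw [IsScalarTower.algebraMap_apply (𝓞 K) K (AlgebraicClosure K), AlgEquiv.commutes]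
  -- the `m + 2` roots `T = g.rootSet K̄`
  have hcardT : Nat.card ((g.map (algebraMap (𝓞 K) K)).rootSet (AlgebraicClosure K)) = m + 2 := by
    rw [Nat.card_eq_fintype_card, card_rootSet_eq_natDegree hsep (IsAlgClosed.splits _), hnatK]
  set T : Set (AlgebraicClosure K) := (g.map (algebraMap (𝓞 K) K)).rootSet (AlgebraicClosure K) with hT
  have hroot : ∀ z : AlgebraicClosure K, z ∈ T ↔ z ^ (m + 2) + a' * z ^ (m + 1) + b' = 0 := by
    intro z
    rw [hT, mem_rootSet_of_ne hmonK.ne_zero, aeval_map_algebraMap, haeval]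
  -- every root is an algebraic integer satisfying the equation in `ℤ̄`
  have hint : ∀ z : AlgebraicClosure K, z ∈ T → IsIntegral (𝓞 K) z := fun z hz =>
    ⟨g, hmon, by rw [← aeval_def, haeval, (hroot z).mp hz]⟩
  let lift : T → absIntegers (𝓞 K) K := fun z => ⟨z.1, (mem_integralClosure_iff _ _).mpr (hint z.1 z.2)⟩
  have hlift : ∀ z : T, ((lift z : absIntegers (𝓞 K) K) : AlgebraicClosure K) = z.1 := fun z => rfl
  have hlift_inj : Function.Injective lift := fun z w h =>
    Subtype.ext (by rw [← hlift z, ← hlift w, h])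
  have heqZ : ∀ z : T, (lift z) ^ (m + 2) + A * (lift z) ^ (m + 1) + B = 0 := by
    intro z
    refine Subtype.ext ?_
    simp only [Subalgebra.coe_add, Subalgebra.coe_mul, Subalgebra.coe_pow, Subalgebra.coe_zero, hlift]
    exact (hroot z.1).mp z.2
  -- (1) a root outside `𝔓`: in `K̄`, `∏_{z} (−a' − z) = g(−a') = b'`
  set rts := (g.map (algebraMap (𝓞 K) (AlgebraicClosure K))).roots with hrts
  have hprod : (rts.map fun z => -a' - z).prod = b' := by
    have hspl := IsAlgClosed.splits (g.map (algebraMap (𝓞 K) (AlgebraicClosure K)))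
    rw [hrts, ← hspl.eval_eq_prod_roots_of_monic (hmon.map _) (-a'), eval_map, ← aeval_def, haeval]
    ring
  have hrtsT : ∀ z ∈ rts, z ∈ T := by
    intro z hz
    rw [hrts, mem_roots (hmon.map _).ne_zero, IsRoot.def, eval_map, ← aeval_def, haeval] at hz
    exact (hroot z).mpr hz
  have hex : ∃ z₀ : T, lift z₀ ∉ 𝔓 := by
    -- transfer the product identity to `ℤ̄` along the injective coercion
    let liftR : AlgebraicClosure K → absIntegers (𝓞 K) K := fun z => if hz : z ∈ T then lift ⟨z, hz⟩ else 0
    have hliftR : ∀ (z) (hz : z ∈ rts), liftR z = lift ⟨z, hrtsT z hz⟩ := fun z hz => by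
      simp only [liftR, dif_pos (hrtsT z hz)]
    have hprodZ : ((rts.map fun z => -A - liftR z).prod : absIntegers (𝓞 K) K) = B := by
      apply Subtype.ext
      have h1 : (((rts.map fun z => -A - liftR z).prod : absIntegers (𝓞 K) K) : AlgebraicClosure K) =
          ((rts.map fun z => -A - liftR z).map (Subalgebra.val (absIntegers (𝓞 K) K))).prod := by
        rw [← map_multiset_prod]; rfl
      rw [h1, Multiset.map_map]
      have h2 : rts.map (⇑(absIntegers (𝓞 K) K).val ∘ fun z => -A - liftR z) = rts.map fun z => -a' - z := by
        refine Multiset.map_congr rfl fun z hz => ?_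
        simp only [Function.comp, Subalgebra.val_apply, Subalgebra.coe_sub, Subalgebra.coe_neg, hliftR z hz]
        rfl
      rw [h2, hprod]
      exact rfl
    have hmem : ((rts.map fun z => -A - liftR z).prod : absIntegers (𝓞 K) K) ∈ 𝔓 := by
      rw [hprodZ]; simpa using hBτ 1
    obtain ⟨y, hy, hy𝔓⟩ := (h𝔓.isPrime.multiset_prod_mem_iff_exists_mem _).mp hmem
    obtain ⟨z, hz, rfl⟩ := Multiset.mem_map.mp hy
    refine ⟨⟨z, hrtsT z hz⟩, fun hz𝔓 => hAτ 1 ?_⟩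
    rw [one_smul]
    rw [hliftR z hz] at hy𝔓
    have hsum := 𝔓.add_mem hy𝔓 hz𝔓
    rw [sub_add_cancel] at hsum
    exact 𝔓.neg_mem_iff.mp hsum
  obtain ⟨z₀, hz₀⟩ := hex
  -- (2) for each root `z` an automorphism `σ_z` of `K̄/K` with `σ_z z₀ = z`
  have hmin : ∀ z : T, g.map (algebraMap (𝓞 K) K) = minpoly K z.1 := fun z =>
    minpoly.eq_of_irreducible_of_monic hirrK (by rw [aeval_map_algebraMap, haeval]; exact (hroot z.1).mp z.2) hmonK
  have hσ : ∀ z : T, ∃ σ : AlgebraicClosure K ≃ₐ[K] AlgebraicClosure K, σ z₀.1 = z.1 := fun z =>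
    minpoly.exists_algEquiv_of_root (Algebra.IsAlgebraic.isAlgebraic z.1)
      (by rw [← hmin z, aeval_map_algebraMap, haeval]; exact (hroot z₀.1).mp z₀.2)
  choose σ hσ using hσ
  let τ : T → absoluteGaloisGroup K := fun z => (absoluteGaloisGroup.toAlgEquiv K).symm (σ z)
  have hτlift : ∀ z : T, τ z • lift z₀ = lift z := fun z =>
    Subtype.ext (by rw [integralClosure.coe_smul, hlift, hlift]; simpa [τ] using hσ z)
  -- (3) `z ↦ τ_z • 𝔓` injects `T` into the orbit: `lift z` is THE root missing from `τ_z • 𝔓`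
  let f : T → MulAction.orbit (absoluteGaloisGroup K) 𝔓 := fun z => ⟨τ z • 𝔓, MulAction.mem_orbit _ _⟩
  have hmiss : ∀ z : T, lift z ∉ τ z • 𝔓 := fun z h =>
    hz₀ (by rw [← hτlift z] at h; exact Ideal.smul_mem_pointwise_smul_iff.mp h)
  have hf : Function.Injective f := by
    intro z w hzw
    have h𝔔 : τ z • 𝔓 = τ w • 𝔓 := congrArg Subtype.val hzw
    apply hlift_inj
    haveI : (τ z • 𝔓).IsPrime := Ideal.IsPrime.smul _
    exact eq_of_pow_add_mul_pow_add_eq_zero_of_notMem (τ z • 𝔓) (hAτ (τ z)) (hBτ (τ z)) m (heqZ z) (heqZ w)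
      (hmiss z) (by rw [h𝔔]; exact hmiss w)
  -- (4) count: `m + 2 = #T ≤ #orbit = m`
  haveI : Finite (MulAction.orbit (absoluteGaloisGroup K) 𝔓) := hfin.to_subtype
  have hle := Nat.card_le_card_of_injective f hf
  rw [hcardT, Nat.card_coe_set_eq, ← hm] at hle
  omega

/-- **`[G_K : D_𝔓] = ∞`**: the stabiliser of `𝔓` has index `0` (Mathlib's convention for infinite index).
[cite: NeukirchANT1999, Ch. II §9] -/
theorem absIntegers.index_stabilizer_eq_zero (𝔓 : Ideal (absIntegers (𝓞 K) K)) [𝔓.IsMaximal] :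
    (MulAction.stabilizer (absoluteGaloisGroup K) 𝔓).index = 0 := by
  rw [MulAction.index_stabilizer]
  exact (absIntegers.infinite_orbit 𝔓).ncard

/-- `D_𝔓` is not of finite index in `G_K`. [cite: NeukirchANT1999, Ch. II §9] -/
theorem absIntegers.not_finiteIndex_stabilizer (𝔓 : Ideal (absIntegers (𝓞 K) K)) [𝔓.IsMaximal] :
    ¬ (MulAction.stabilizer (absoluteGaloisGroup K) 𝔓).FiniteIndex := fun h =>
  h.index_ne_zero (absIntegers.index_stabilizer_eq_zero 𝔓)

/-- **`D_𝔓` is NOT OPEN in `G_K`** (an open subgroup of the compact group `G_K` has finite index).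
[cite: NeukirchANT1999, Ch. II §9] -/
theorem absIntegers.not_isOpen_stabilizer (𝔓 : Ideal (absIntegers (𝓞 K) K)) [𝔓.IsMaximal] :
    ¬ IsOpen (MulAction.stabilizer (absoluteGaloisGroup K) 𝔓 : Set (absoluteGaloisGroup K)) := by
  intro h
  haveI := Subgroup.quotient_finite_of_isOpen _ h
  haveI : (MulAction.stabilizer (absoluteGaloisGroup K) 𝔓).FiniteIndex := Subgroup.finiteIndex_of_finite_quotient
  exact absIntegers.not_finiteIndex_stabilizer 𝔓 ‹_›

end Orbit

end Literature.NumberTheory.GaloisRepresentations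

/-! ### §4. Infinitely many primes of `ℤ̄` above each finite place -/

namespace IsDedekindDomain.HeightOneSpectrum

open Literature.NumberTheory.GaloisRepresentations Field

-- the pointwise `G_K`-actions on `ℤ̄` and on its ideals are found slowly
set_option synthInstance.maxHeartbeats 160000

variable {K : Type*} [Field K] [NumberField K]

/-- **Infinitely many primes of `ℤ̄` lie above every finite place `v` of a number field `K`**: `v.primesAbove` contains
the infinite `G_K`-orbit of any of its members (`absIntegers.infinite_orbit`; conjugates stay above `v`, `Ideal.under_smul`).
[cite: NeukirchANT1999, Ch. II §8] -/
theorem infinite_primesAbove (v : HeightOneSpectrum (𝓞 K)) : (v.primesAbove).Infinite := by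
  obtain ⟨𝔓, h𝔓⟩ := v.primesAbove_nonempty
  haveI := isMaximal_of_mem_primesAbove h𝔓
  refine (absIntegers.infinite_orbit 𝔓).mono ?_
  rintro _ ⟨σ, rfl⟩
  obtain ⟨_, hover⟩ := mem_primesAbove_iff.mp h𝔓
  refine mem_primesAbove_iff.mpr ⟨Ideal.IsPrime.smul _, ⟨?_⟩⟩
  change v.asIdeal = (σ • 𝔓).under (𝓞 K)
  rw [Ideal.under_smul]
  exact hover.over

end IsDedekindDomain.HeightOneSpectrum

/-! ### §5. The same for non-trivial valuation rings of `K̄` -/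

namespace Literature.NumberTheory.GaloisRepresentations

open Field

set_option synthInstance.maxHeartbeats 160000

variable {K : Type*} [Field K] [NumberField K] (A : ValuationSubring (AlgebraicClosure K))

/-- For a valuation ring `A ≠ K̄` of `K̄`: `[G_K : Stab(A)] = ∞` (the stabiliser of `A` is that of its centre
`𝔪_A ∩ ℤ̄`, a maximal ideal; `absIntegers.index_stabilizer_eq_zero`). [cite: NeukirchANT1999, Ch. II §9] -/
theorem ValuationSubring.index_stabilizer_eq_zero_of_ne_top (hA : A ≠ ⊤) :
    (MulAction.stabilizer (absoluteGaloisGroup K) A).index = 0 := by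
  haveI := absIntegersCentre_isMaximal A hA
  rw [stabilizer_eq_stabilizer_absIntegersCentre A hA]
  exact absIntegers.index_stabilizer_eq_zero (absIntegersCentre A)

/-- For a valuation ring `A ≠ K̄` of `K̄`: the `G_K`-orbit of `A` (the finite places of `K̄` over the place of `K` under
`A`) is INFINITE. [cite: NeukirchANT1999, Ch. II §8] -/
theorem ValuationSubring.infinite_orbit_of_ne_top (hA : A ≠ ⊤) :
    (MulAction.orbit (absoluteGaloisGroup K) A).Infinite := by
  intro hfin
  have h := ValuationSubring.index_stabilizer_eq_zero_of_ne_top A hA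
  rw [MulAction.index_stabilizer, Set.ncard_eq_zero hfin] at h
  exact (Set.nonempty_iff_ne_empty.mp ⟨A, MulAction.mem_orbit_self A⟩) h

/-- For a valuation ring `A ≠ K̄` of `K̄`: its decomposition group `Stab_{G_K}(A)` is NOT OPEN — the (S⊚′) input «only `⊚`
has an open decomposition group» of [AbsTopIII] Def 5.1 at the genuine pro-set, elementary route.
[cite: NeukirchANT1999, Ch. II §9] -/
theorem ValuationSubring.not_isOpen_stabilizer_of_ne_top (hA : A ≠ ⊤) :
    ¬ IsOpen (MulAction.stabilizer (absoluteGaloisGroup K) A : Set (absoluteGaloisGroup K)) := by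
  haveI := absIntegersCentre_isMaximal A hA
  rw [stabilizer_eq_stabilizer_absIntegersCentre A hA]
  exact absIntegers.not_isOpen_stabilizer (absIntegersCentre A)

end Literature.NumberTheory.GaloisRepresentations

end
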